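import Mathlib
import Literature.NumberTheory.LFunctions.Zhang2022.Section17U021ChiR1CaseA
import Literature.NumberTheory.LFunctions.Zhang2022.Section10RangeToolkit
import HarnessLib

/-!
# Zhang (2022) §17.u021 (χ-reading), remainder `R₁` — piece M2s: the `m₂`-sum over SMALL arguments
# (`l₂m₂ ≤ D⁴`) with the weight `|κ₂(m₂)|·(m₂/φ(m₂))²` of the «m₁ inside» organisation

Topic `Literature/NumberTheory/LFunctions/Zhang2022` (Landau–Siegel audit tree; verdict-neutral).
Y. Zhang, *Discrete mean estimates and the Landau–Siegel zero*, arXiv:2211.02515v1 (2022)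
[Zhang2022LandauSiegel] — **an unrefereed manuscript under adjudication; nothing here asserts or denies
its Theorems 1–2.** Lane ZHANG-L, WP16, sub-leaf `R1Rel` (the `m₂ ≥ 2` remainder of §17.u021, relative
currency; owner zl-libB-p6 g2, CUT 2026-08-27T02:29:31Z «m₁ inside»: `‖κ̄₂(m₁m₂)‖ = ‖κ₂(m₂)‖·∏_{p∣m₁,p∤m₂}ε_p`,
so the `m₁`-sum (piece M1) returns the weight `‖κ₂(m₂)‖·(m₂/φ(m₂))²` and EVERY `m₂ ≥ 2` carries the gain).
This file = piece **M2s** (helper zl-w10-p5): §17 p. 98, tex L4825.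

* `tau_prod_primes_le` — `τ_j(∏_{q∈t}q) ≤ ∏_{q∈t}2^j` (`= 2^{j|t|}`) for a set `t` of primes;
* `sum_filter_dvd_tau_div_le` — `Σ_{n≤N, m∣n} τ_j(n)/n ≤ (τ_j(m)/m)(1 + log(N/m))^j`;
* `sum_tau_mul_ratio_sq_div_le` — **`Σ_{n≤N} τ_j(n)(n/φ(n))²/n ≤ e^{2^{j+3}}(1+log N)^j`** (the
  `(n/φ(n))²`-weight costs NO exponent: expansion `(n/φ)² = Σ_{t⊆P(n)}∏_{q∈t}((q/(q−1))²−1)` of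
  `Skeleton.ratio_pow_eq_sum_powerset`, multiples of `∏t`, Euler product `∏(1 + 8·2^j/q²) ≤ e^{2^{j+3}}`);
* `smallArgs_sum_le` — **M2s**: for `l₂ ≥ 1`, `l₂N ≤ D⁴`, `|b₁|log D⁴ ≤ 1` and the §17 weight facts
  (`‖nN_β(n) − 1‖ ≤ δ ≤ 1`, `n ≤ D⁴`):
  `Σ_{2≤m₂≤N, (m₂,l₁)=1} ‖ν₁*(l₂m₂)‖·‖κ̄₂(m₂)‖·(m₂/φ(m₂))²/m₂ ≤
   (|b₁|log D⁴)·(e^{32}·‖(μχ∗1)(l₂)‖·(1+log N)² + 3e^{128}·δ·τ₄(l₂)·(1+log N)⁴)`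
  (gain: every prime of `m₂ ≥ 2` is `≤ D⁴`, `Typed.Section17.norm_kappa2bar_mul_le_of_prime` at `m₁ = 1`;
  `ν₁*`: `Phi3Eval.norm_nuOneStar_le` + `norm_nuMinus_mul_le_tau` + `tau_mul_le`, as in piece A2).

Theorems only; no definitions, no named facts; axioms standard.

## References

* Y. Zhang, arXiv:2211.02515v1 (2022), §17 p. 98 (u021, tex L4825); App. A p. 105 (`κ₂`).
  [cite: Zhang2022LandauSiegel, §17 u021 p.98]
* R. R. Hall, G. Tenenbaum, *Divisors*, CUP 1988, (0.4). [cite: HallTenenbaum1988, (0.4)]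
-/

noncomputable section

open Complex Real ComplexConjugate Finset ArithmeticFunction

namespace Literature.NumberTheory.LFunctions.Zhang2022.Typed.Section17

open Literature.NumberTheory.LFunctions.Zhang2022
open Literature.NumberTheory.LFunctions.Zhang2022.Skeleton
open Literature.NumberTheory.LFunctions.Zhang2022.MeanSquareMajorant
open Literature.NumberTheory.LFunctions.Zhang2022.Phi3Eval (norm_nuOneStar_le norm_nuMinus_mul_le_tau)

/-! ## `Σ_{n≤N} τ_j(n)(n/φ(n))²/n ≪ (log N)^j` -/

/-- `τ_j(∏_{q∈t} q) ≤ ∏_{q∈t} 2^j` for a finite set `t` of primes (sub-multiplicativity and `τ_j(q) ≤ 2^j`).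
[cite: HallTenenbaum1988, (0.4)] -/
theorem tau_prod_primes_le (j : ℕ) (t : Finset ℕ) (ht : ∀ q ∈ t, q.Prime) :
    tau j (∏ q ∈ t, q) ≤ ∏ _q ∈ t, (2 : ℝ) ^ j := by
  classical
  induction t using Finset.induction_on with
  | empty =>
    simp only [Finset.prod_empty]
    rw [(isMultiplicative_tau j).map_one]
  | insert a s has ih =>
    rw [Finset.prod_insert has, Finset.prod_insert has]
    have ha : a.Prime := ht a (Finset.mem_insert_self a s)
    have hs : ∀ q ∈ s, q.Prime := fun q hq => ht q (Finset.mem_insert_of_mem hq)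
    have h1 : tau j a ≤ (2 : ℝ) ^ j := by
      have h := (isBlock_tau j).pow_le a 1 ha
      rw [pow_one] at h
      refine h.trans (le_of_eq ?_)
      norm_num
    calc tau j (a * ∏ q ∈ s, q) ≤ tau j a * tau j (∏ q ∈ s, q) := tau_mul_le j a _
      _ ≤ (2 : ℝ) ^ j * ∏ _q ∈ s, (2 : ℝ) ^ j :=
          mul_le_mul h1 (ih hs) (tau_nonneg _ _) (by positivity)

/-- Multiples of `m`: `Σ_{1≤n≤N, m∣n} τ_j(n)/n ≤ (τ_j(m)/m)·(1 + log(N/m))^j` (`n = mk`, `τ_j(mk) ≤ τ_j(m)τ_j(k)`,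
`ToolkitDivisorMajorants.sum_tau_mul_div_Icc_le`). [cite: HallTenenbaum1988, (0.4)] -/
theorem sum_filter_dvd_tau_div_le (j : ℕ) {m : ℕ} (hm : 0 < m) (N : ℕ) :
    ∑ n ∈ (Finset.Icc 1 N).filter (fun n => m ∣ n), tau j n / n ≤
      tau j m / m * (1 + Real.log ((N / m : ℕ) : ℝ)) ^ j := by
  classical
  have hset : (Finset.Icc 1 N).filter (fun n => m ∣ n) =
      (Finset.Icc 1 (N / m)).image (fun k => m * k) := by
    ext n
    simp only [Finset.mem_filter, Finset.mem_Icc, Finset.mem_image]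
    constructor
    · rintro ⟨⟨h1, h2⟩, ⟨k, rfl⟩⟩
      refine ⟨k, ⟨?_, ?_⟩, rfl⟩
      · rcases Nat.eq_zero_or_pos k with hk | hk
        · subst hk; simp at h1
        · exact hk
      · exact (Nat.le_div_iff_mul_le hm).mpr (by rw [mul_comm]; exact h2)
    · rintro ⟨k, ⟨h1, h2⟩, rfl⟩
      refine ⟨⟨Nat.mul_pos hm (by omega), ?_⟩, dvd_mul_right m k⟩
      have := (Nat.le_div_iff_mul_le hm).mp h2
      rw [mul_comm]; exact this
  rw [hset, Finset.sum_image (fun a _ b _ h => Nat.eq_of_mul_eq_mul_left hm h)]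
  have hm0 : (0 : ℝ) < m := by exact_mod_cast hm
  have hterm : ∀ k ∈ Finset.Icc 1 (N / m), tau j (m * k) / ((m * k : ℕ) : ℝ) ≤ (1 / (m : ℝ)) * (tau j (m * k) / k) := by
    intro k hk
    have hk0 : (0 : ℝ) < k := by exact_mod_cast (Finset.mem_Icc.1 hk).1
    rw [Nat.cast_mul]
    refine le_of_eq ?_
    field_simp
  calc ∑ k ∈ Finset.Icc 1 (N / m), tau j (m * k) / ((m * k : ℕ) : ℝ)
      ≤ ∑ k ∈ Finset.Icc 1 (N / m), (1 / (m : ℝ)) * (tau j (m * k) / k) := Finset.sum_le_sum hterm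
    _ = (1 / (m : ℝ)) * ∑ k ∈ Finset.Icc 1 (N / m), tau j (m * k) / k := by rw [Finset.mul_sum]
    _ ≤ (1 / (m : ℝ)) * (tau j m * (1 + Real.log ((N / m : ℕ) : ℝ)) ^ j) :=
        mul_le_mul_of_nonneg_left (sum_tau_mul_div_Icc_le j m (N / m)) (by positivity)
    _ = tau j m / m * (1 + Real.log ((N / m : ℕ) : ℝ)) ^ j := by ring

/-- **`Σ_{1≤n≤N} τ_j(n)(n/φ(n))²/n ≤ e^{2^{j+3}}·(1 + log N)^j`** — the `(n/φ(n))²`-weighted divisor sum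
has the same logarithmic order as `Σ τ_j(n)/n`. [cite: HallTenenbaum1988, (0.4)] -/
theorem sum_tau_mul_ratio_sq_div_le (j N : ℕ) :
    ∑ n ∈ Finset.Icc 1 N, tau j n * ((n : ℝ) / Nat.totient n) ^ 2 / n ≤
      Real.exp (2 ^ (j + 3)) * (1 + Real.log N) ^ j := by
  classical
  set a : ℕ → ℝ := fun q => ((q : ℝ) / (q - 1)) ^ 2 - 1 with ha
  set L : ℝ := (1 + Real.log N) ^ j with hL
  set PB : Finset ℕ := (Finset.Icc 1 N).filter Nat.Prime with hPB
  have hlogN : 0 ≤ Real.log (N : ℝ) := Real.log_natCast_nonneg N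
  have hL0 : 0 ≤ L := by rw [hL]; positivity
  have ha0 : ∀ q, q.Prime → 0 ≤ a q := fun q hq => (ratio_pow_sub_one_bounds 2 hq.two_le).1
  -- (1) expand and swap
  have step1 : ∑ n ∈ Finset.Icc 1 N, tau j n * ((n : ℝ) / Nat.totient n) ^ 2 / n =
      ∑ n ∈ Finset.Icc 1 N, ∑ t ∈ n.primeFactors.powerset, tau j n * (∏ q ∈ t, a q) / n := by
    refine Finset.sum_congr rfl fun n hn => ?_
    have hn0 : n ≠ 0 := by have := (Finset.mem_Icc.mp hn).1; omega
    rw [ratio_pow_eq_sum_powerset 2 hn0, Finset.mul_sum, Finset.sum_div]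
  have step2 : ∑ n ∈ Finset.Icc 1 N, ∑ t ∈ n.primeFactors.powerset, tau j n * (∏ q ∈ t, a q) / n =
      ∑ t ∈ PB.powerset, ∑ n ∈ (Finset.Icc 1 N).filter (fun n => t ⊆ n.primeFactors),
        tau j n * (∏ q ∈ t, a q) / n := by
    refine Finset.sum_comm' fun n t => ?_
    simp only [Finset.mem_powerset, Finset.mem_filter, Finset.mem_Icc]
    constructor
    · rintro ⟨hn, ht⟩
      refine ⟨⟨hn, ht⟩, ?_⟩
      intro q hq
      have hq' := ht hq
      rw [hPB, Finset.mem_filter, Finset.mem_Icc]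
      have hqp := Nat.prime_of_mem_primeFactors hq'
      have hn0 : n ≠ 0 := by omega
      exact ⟨⟨hqp.one_le, le_trans (Nat.le_of_dvd (Nat.pos_of_ne_zero hn0)
        (Nat.dvd_of_mem_primeFactors hq')) hn.2⟩, hqp⟩
    · rintro ⟨⟨hn, ht⟩, -⟩
      exact ⟨hn, ht⟩
  -- (2) the inner sums
  have inner : ∀ t ∈ PB.powerset,
      ∑ n ∈ (Finset.Icc 1 N).filter (fun n => t ⊆ n.primeFactors), tau j n * (∏ q ∈ t, a q) / n ≤
        (∏ q ∈ t, (2 : ℝ) ^ j * a q / q) * L := by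
    intro t ht
    rw [Finset.mem_powerset] at ht
    have htp : ∀ q ∈ t, q.Prime := fun q hq => (Finset.mem_filter.mp (ht hq)).2
    have hprod0 : 0 ≤ ∏ q ∈ t, a q := Finset.prod_nonneg fun q hq => ha0 q (htp q hq)
    set m : ℕ := ∏ q ∈ t, q with hm
    have hm0 : 0 < m := Finset.prod_pos fun q hq => (htp q hq).pos
    have hsub : (Finset.Icc 1 N).filter (fun n => t ⊆ n.primeFactors) ⊆
        (Finset.Icc 1 N).filter (fun n => m ∣ n) := by
      intro n hn
      rw [Finset.mem_filter] at hn ⊢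
      refine ⟨hn.1, ?_⟩
      exact (Finset.prod_dvd_prod_of_subset _ _ (fun q => q) hn.2).trans (Nat.prod_primeFactors_dvd n)
    -- `τ_j(m) ≤ ∏ 2^j`, `(1 + log(N/m))^j ≤ L`
    have hτm : tau j m ≤ ∏ _q ∈ t, (2 : ℝ) ^ j := tau_prod_primes_le j t htp
    have hlogle : (1 + Real.log ((N / m : ℕ) : ℝ)) ^ j ≤ L := by
      rw [hL]
      have h0 : 0 ≤ Real.log ((N / m : ℕ) : ℝ) := Real.log_natCast_nonneg _
      have h1 : Real.log ((N / m : ℕ) : ℝ) ≤ Real.log N := by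
        rcases Nat.eq_zero_or_pos (N / m) with hz | hz
        · rw [hz]; simp [hlogN]
        · exact Real.log_le_log (by exact_mod_cast hz) (by exact_mod_cast Nat.div_le_self N m)
      exact pow_le_pow_left₀ (by linarith) (by linarith) j
    calc ∑ n ∈ (Finset.Icc 1 N).filter (fun n => t ⊆ n.primeFactors), tau j n * (∏ q ∈ t, a q) / n
        ≤ ∑ n ∈ (Finset.Icc 1 N).filter (fun n => m ∣ n), tau j n * (∏ q ∈ t, a q) / n :=
          Finset.sum_le_sum_of_subset_of_nonneg hsub fun n _ _ => by
            have := tau_nonneg j n; positivity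
      _ = (∏ q ∈ t, a q) * ∑ n ∈ (Finset.Icc 1 N).filter (fun n => m ∣ n), tau j n / n := by
          rw [Finset.mul_sum]
          refine Finset.sum_congr rfl fun n _ => by ring
      _ ≤ (∏ q ∈ t, a q) * (tau j m / m * (1 + Real.log ((N / m : ℕ) : ℝ)) ^ j) :=
          mul_le_mul_of_nonneg_left (sum_filter_dvd_tau_div_le j hm0 N) hprod0
      _ ≤ (∏ q ∈ t, a q) * ((∏ _q ∈ t, (2 : ℝ) ^ j) / m * L) := by
          refine mul_le_mul_of_nonneg_left ?_ hprod0
          have hm0' : (0 : ℝ) < m := by exact_mod_cast hm0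
          have h0 : 0 ≤ (1 + Real.log ((N / m : ℕ) : ℝ)) ^ j := by
            have := Real.log_natCast_nonneg (N / m); positivity
          exact mul_le_mul (div_le_div_of_nonneg_right hτm hm0'.le) hlogle h0 (by positivity)
      _ = (∏ q ∈ t, (2 : ℝ) ^ j * a q / q) * L := by
          have e1 : (∏ _q ∈ t, (2 : ℝ) ^ j) / (m : ℝ) = ∏ q ∈ t, (2 : ℝ) ^ j / (q : ℝ) := by
            rw [hm, Nat.cast_prod, ← Finset.prod_div_distrib]
          have e2 : (∏ q ∈ t, a q) * ∏ q ∈ t, (2 : ℝ) ^ j / (q : ℝ) = ∏ q ∈ t, (2 : ℝ) ^ j * a q / q := by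
            rw [← Finset.prod_mul_distrib]; exact Finset.prod_congr rfl fun q _ => by ring
          rw [e1, ← e2]; ring
  -- (3) the Euler product
  have step3 : ∑ t ∈ PB.powerset, (∏ q ∈ t, (2 : ℝ) ^ j * a q / q) * L =
      (∏ q ∈ PB, (1 + (2 : ℝ) ^ j * a q / q)) * L := by
    rw [← Finset.sum_mul, Finset.prod_one_add]
  have step4 : ∏ q ∈ PB, (1 + (2 : ℝ) ^ j * a q / q) ≤ Real.exp (2 ^ (j + 3)) := by
    have hq2 : ∀ q ∈ PB, (2 : ℕ) ≤ q := fun q hq => (Finset.mem_filter.mp hq).2.two_le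
    have h1 : ∏ q ∈ PB, (1 + (2 : ℝ) ^ j * a q / q) ≤ ∏ q ∈ PB, Real.exp ((2 : ℝ) ^ j * a q / q) := by
      refine Finset.prod_le_prod (fun q hq => ?_) fun q hq => ?_
      · have := ha0 q (Finset.mem_filter.mp hq).2
        positivity
      · have := Real.add_one_le_exp ((2 : ℝ) ^ j * a q / q)
        linarith
    refine h1.trans ?_
    rw [← Real.exp_sum]
    refine Real.exp_le_exp.mpr ?_
    have h2 : ∑ q ∈ PB, (2 : ℝ) ^ j * a q / q ≤ ∑ q ∈ PB, (2 : ℝ) ^ (j + 3) * ((q : ℝ) ^ 2)⁻¹ := by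
      refine Finset.sum_le_sum fun q hq => ?_
      have hq := hq2 q hq
      have hqr : (0 : ℝ) < q := by exact_mod_cast lt_of_lt_of_le (by norm_num) hq
      have hb := (ratio_pow_sub_one_bounds 2 hq).2
      calc (2 : ℝ) ^ j * a q / q ≤ (2 : ℝ) ^ j * (2 ^ (2 + 1) / q) / q := by gcongr
        _ = (2 : ℝ) ^ (j + 3) * ((q : ℝ) ^ 2)⁻¹ := by rw [pow_add]; field_simp; ring
    refine h2.trans ?_
    rw [← Finset.mul_sum]
    have h3 : ∑ q ∈ PB, ((q : ℝ) ^ 2)⁻¹ ≤ 1 := by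
      have hsub : PB ⊆ Finset.Ioo 1 (N + 1) := by
        intro q hq
        rw [hPB, Finset.mem_filter, Finset.mem_Icc] at hq
        rw [Finset.mem_Ioo]
        exact ⟨hq.2.one_lt, Nat.lt_succ_of_le hq.1.2⟩
      calc ∑ q ∈ PB, ((q : ℝ) ^ 2)⁻¹ ≤ ∑ q ∈ Finset.Ioo 1 (N + 1), ((q : ℝ) ^ 2)⁻¹ :=
            Finset.sum_le_sum_of_subset_of_nonneg hsub fun q _ _ => by positivity
        _ ≤ 2 / (((1 : ℕ) : ℝ) + 1) := sum_Ioo_inv_sq_le 1 (N + 1)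
        _ = 1 := by norm_num
    calc (2 : ℝ) ^ (j + 3) * ∑ q ∈ PB, ((q : ℝ) ^ 2)⁻¹ ≤ 2 ^ (j + 3) * 1 := by gcongr
      _ = 2 ^ (j + 3) := mul_one _
  -- assemble
  rw [step1, step2]
  calc ∑ t ∈ PB.powerset, ∑ n ∈ (Finset.Icc 1 N).filter (fun n => t ⊆ n.primeFactors),
          tau j n * (∏ q ∈ t, a q) / n
      ≤ ∑ t ∈ PB.powerset, (∏ q ∈ t, (2 : ℝ) ^ j * a q / q) * L := Finset.sum_le_sum inner
    _ = (∏ q ∈ PB, (1 + (2 : ℝ) ^ j * a q / q)) * L := step3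
    _ ≤ Real.exp (2 ^ (j + 3)) * L := by gcongr
    _ = Real.exp (2 ^ (j + 3)) * (1 + Real.log N) ^ j := by rw [hL]

/-! ## M2s: the small-argument `m₂`-sum of the «m₁ inside» organisation -/

/-- **M2s (CUT 2026-08-27T02:29:31Z): the `m₂`-sum over small arguments.** Let `δ ∈ [0,1]` bound the
§17 weight defects `‖nN_β(n) − 1‖` for `n ≤ D⁴` (`β = β₂, β₃`), let `|b₁|log D⁴ ≤ 1`, `l₂ ≥ 1` and
`l₂N ≤ D⁴`. Then
`Σ_{2≤m₂≤N, (m₂,l₁)=1} ‖ν₁*(l₂m₂)‖·‖κ̄₂(m₂)‖·(m₂/φ(m₂))²/m₂ ≤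
(|b₁|log D⁴)·(e^{32}·‖(μχ∗1)(l₂)‖·(1+log N)² + 3e^{128}·δ·τ₄(l₂)·(1+log N)⁴)`.
[cite: Zhang2022LandauSiegel, §17 u021 p.98] -/
theorem smallArgs_sum_le (c' : ℝ) {D : ℕ} (χ : DirichletCharacter ℂ D) {δ : ℝ} (hδ0 : 0 ≤ δ) (hδ1 : δ ≤ 1)
    (hη : ∀ n : ℕ, n ≠ 0 → n ≤ D ^ 4 →
      ‖nN D (beta2 c' D) n - 1‖ ≤ δ ∧ ‖nN D (beta3 c' D) n - 1‖ ≤ δ)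
    (hb : |b1 c' D| * Real.log ((D : ℝ) ^ 4) ≤ 1)
    {l₁ l₂ N : ℕ} (hl₂ : 1 ≤ l₂) (hN : l₂ * N ≤ D ^ 4) :
    ∑ m₂ ∈ (Finset.Icc 2 N).filter (fun m₂ => Nat.Coprime m₂ l₁),
        ‖nuOneStar c' χ (l₂ * m₂)‖ * ‖kappa2bar c' D m₂‖ * ((m₂ : ℝ) / Nat.totient m₂) ^ 2 / m₂ ≤
      (|b1 c' D| * Real.log ((D : ℝ) ^ 4)) *
        (Real.exp 32 * ‖∑ d ∈ l₂.divisors, (ArithmeticFunction.moebius d : ℂ) * χ (d : ZMod D)‖ *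
            (1 + Real.log N) ^ 2 +
          3 * Real.exp 128 * δ * tau 4 l₂ * (1 + Real.log N) ^ 4) := by
  set θ : ℝ := |b1 c' D| * Real.log ((D : ℝ) ^ 4) with hθ
  set Ml₂ : ℝ := ‖∑ d ∈ l₂.divisors, (ArithmeticFunction.moebius d : ℂ) * χ (d : ZMod D)‖ with hMl₂
  have hθ0 : 0 ≤ θ := by
    rw [hθ]
    rcases Nat.eq_zero_or_pos D with hD | hD
    · simp [hD]
    · exact mul_nonneg (abs_nonneg _) (Real.log_nonneg (by exact_mod_cast Nat.one_le_pow 4 D hD))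
  have hl₂0 : l₂ ≠ 0 := by omega
  have hND : N ≤ D ^ 4 := le_trans (Nat.le_mul_of_pos_left N (by omega)) hN
  have hlogq : ∀ {m₂ : ℕ}, m₂ ≤ N → ∀ q ∈ m₂.primeFactors, |b1 c' D| * Real.log q ≤ θ := by
    intro m₂ hm₂ q hq
    have hqle : q ≤ m₂ := Nat.le_of_mem_primeFactors hq
    have hq1 : 1 ≤ q := (Nat.prime_of_mem_primeFactors hq).one_lt.le
    have hqD : (q : ℝ) ≤ (D : ℝ) ^ 4 := by exact_mod_cast hqle.trans (hm₂.trans hND)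
    rw [hθ]
    exact mul_le_mul_of_nonneg_left (Real.log_le_log (by exact_mod_cast hq1) hqD) (abs_nonneg _)
  -- `‖κ̄₂(1)‖ = 1`
  have hκ1 : ‖kappa2bar c' D 1‖ = 1 := by
    rw [norm_kappa2bar_eq, (isMultiplicative_kappa₂ _).map_one, norm_one]
  -- termwise
  have hterm : ∀ m₂ ∈ (Finset.Icc 2 N).filter (fun m₂ => Nat.Coprime m₂ l₁),
      ‖nuOneStar c' χ (l₂ * m₂)‖ * ‖kappa2bar c' D m₂‖ * ((m₂ : ℝ) / Nat.totient m₂) ^ 2 / m₂ ≤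
        θ * ((Ml₂ * tau 2 m₂ + 3 * δ * tau 4 l₂ * tau 4 m₂) * ((m₂ : ℝ) / Nat.totient m₂) ^ 2 / m₂) := by
    intro m₂ hm
    rw [Finset.mem_filter, Finset.mem_Icc] at hm
    obtain ⟨⟨hm2, hmN⟩, -⟩ := hm
    have hm₂0 : m₂ ≠ 0 := by omega
    have hm₂pos : (0 : ℝ) < m₂ := by exact_mod_cast (by omega : 0 < m₂)
    -- the gain: a prime of `m₂ ≥ 2`
    obtain ⟨p, hp⟩ : m₂.primeFactors.Nonempty :=
      Nat.nonempty_primeFactors.mpr (by omega)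
    have hgain : ‖kappa2bar c' D m₂‖ ≤ θ := by
      have hsmall : ∀ q ∈ m₂.primeFactors, |b1 c' D| * Real.log q ≤ 1 :=
        fun q hq => (hlogq hmN q hq).trans hb
      have hpm : ¬ p ∣ 1 := (Nat.prime_of_mem_primeFactors hp).not_dvd_one
      have h := norm_kappa2bar_mul_le_of_prime c' D one_ne_zero hm₂0 hp hpm hsmall
      rw [one_mul, hκ1, mul_one] at h
      exact h.trans (hlogq hmN p hp)
    -- the `ν₁*` majorant
    have hlm : l₂ * m₂ ≤ D ^ 4 := le_trans (Nat.mul_le_mul_left l₂ hmN) hN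
    have hν : ‖nuOneStar c' χ (l₂ * m₂)‖ ≤ Ml₂ * tau 2 m₂ + 3 * δ * tau 4 l₂ * tau 4 m₂ := by
      refine (norm_nuOneStar_le c' χ hδ0 hδ1 hlm hη).trans ?_
      refine add_le_add ((norm_nuMinus_mul_le_tau χ hl₂0 hm₂0).trans_eq (by rw [tau_two_apply])) ?_
      calc 3 * δ * tau 4 (l₂ * m₂) ≤ 3 * δ * (tau 4 l₂ * tau 4 m₂) :=
            mul_le_mul_of_nonneg_left (tau_mul_le 4 l₂ m₂) (by positivity)
        _ = 3 * δ * tau 4 l₂ * tau 4 m₂ := by ring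
    have hB0 : 0 ≤ Ml₂ * tau 2 m₂ + 3 * δ * tau 4 l₂ * tau 4 m₂ :=
      add_nonneg (mul_nonneg (norm_nonneg _) (tau_nonneg _ _)) (by
        have := tau_nonneg 4 l₂; have := tau_nonneg 4 m₂; positivity)
    have hw0 : 0 ≤ ((m₂ : ℝ) / Nat.totient m₂) ^ 2 / m₂ := by positivity
    calc ‖nuOneStar c' χ (l₂ * m₂)‖ * ‖kappa2bar c' D m₂‖ * ((m₂ : ℝ) / Nat.totient m₂) ^ 2 / m₂
        = (‖nuOneStar c' χ (l₂ * m₂)‖ * ‖kappa2bar c' D m₂‖) * (((m₂ : ℝ) / Nat.totient m₂) ^ 2 / m₂) := by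
          ring
      _ ≤ ((Ml₂ * tau 2 m₂ + 3 * δ * tau 4 l₂ * tau 4 m₂) * θ) * (((m₂ : ℝ) / Nat.totient m₂) ^ 2 / m₂) :=
          mul_le_mul_of_nonneg_right (mul_le_mul hν hgain (norm_nonneg _) hB0) hw0
      _ = θ * ((Ml₂ * tau 2 m₂ + 3 * δ * tau 4 l₂ * tau 4 m₂) * ((m₂ : ℝ) / Nat.totient m₂) ^ 2 / m₂) := by
          ring
  -- sum over the filter ⊆ `Icc 1 N`
  have hsub : (Finset.Icc 2 N).filter (fun m₂ => Nat.Coprime m₂ l₁) ⊆ Finset.Icc 1 N := fun m₂ hm => by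
    rw [Finset.mem_filter, Finset.mem_Icc] at hm
    rw [Finset.mem_Icc]; omega
  have hnonneg : ∀ m₂ ∈ Finset.Icc 1 N,
      0 ≤ θ * ((Ml₂ * tau 2 m₂ + 3 * δ * tau 4 l₂ * tau 4 m₂) * ((m₂ : ℝ) / Nat.totient m₂) ^ 2 / m₂) := by
    intro m₂ _
    have : 0 ≤ Ml₂ * tau 2 m₂ + 3 * δ * tau 4 l₂ * tau 4 m₂ :=
      add_nonneg (mul_nonneg (norm_nonneg _) (tau_nonneg _ _)) (by
        have := tau_nonneg 4 l₂; have := tau_nonneg 4 m₂; positivity)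
    positivity
  have h2 := sum_tau_mul_ratio_sq_div_le 2 N
  have h4 := sum_tau_mul_ratio_sq_div_le 4 N
  have e2 : Real.exp (2 ^ (2 + 3)) = Real.exp 32 := by norm_num
  have e4 : Real.exp (2 ^ (4 + 3)) = Real.exp 128 := by norm_num
  rw [e2] at h2
  rw [e4] at h4
  calc ∑ m₂ ∈ (Finset.Icc 2 N).filter (fun m₂ => Nat.Coprime m₂ l₁),
        ‖nuOneStar c' χ (l₂ * m₂)‖ * ‖kappa2bar c' D m₂‖ * ((m₂ : ℝ) / Nat.totient m₂) ^ 2 / m₂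
      ≤ ∑ m₂ ∈ (Finset.Icc 2 N).filter (fun m₂ => Nat.Coprime m₂ l₁),
          θ * ((Ml₂ * tau 2 m₂ + 3 * δ * tau 4 l₂ * tau 4 m₂) * ((m₂ : ℝ) / Nat.totient m₂) ^ 2 / m₂) :=
        Finset.sum_le_sum hterm
    _ ≤ ∑ m₂ ∈ Finset.Icc 1 N,
          θ * ((Ml₂ * tau 2 m₂ + 3 * δ * tau 4 l₂ * tau 4 m₂) * ((m₂ : ℝ) / Nat.totient m₂) ^ 2 / m₂) :=
        Finset.sum_le_sum_of_subset_of_nonneg hsub fun m₂ hm _ => hnonneg m₂ hm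
    _ = θ * (Ml₂ * ∑ m₂ ∈ Finset.Icc 1 N, tau 2 m₂ * ((m₂ : ℝ) / Nat.totient m₂) ^ 2 / m₂ +
          3 * δ * tau 4 l₂ * ∑ m₂ ∈ Finset.Icc 1 N, tau 4 m₂ * ((m₂ : ℝ) / Nat.totient m₂) ^ 2 / m₂) := by
        simp only [Finset.mul_sum, ← Finset.sum_add_distrib]
        exact Finset.sum_congr rfl fun m₂ _ => by ring
    _ ≤ θ * (Ml₂ * (Real.exp 32 * (1 + Real.log N) ^ 2) +
          3 * δ * tau 4 l₂ * (Real.exp 128 * (1 + Real.log N) ^ 4)) := by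
        have hτ4 : 0 ≤ 3 * δ * tau 4 l₂ := by have := tau_nonneg 4 l₂; positivity
        gcongr
    _ = θ * (Real.exp 32 * Ml₂ * (1 + Real.log N) ^ 2 +
          3 * Real.exp 128 * δ * tau 4 l₂ * (1 + Real.log N) ^ 4) := by ring

end Literature.NumberTheory.LFunctions.Zhang2022.Typed.Section17
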